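import Summits.BirchSwinnertonDyer.BirchSwinnertonDyer.Theorems.SylvesterTwoHeegnerIndexUpperOffV0PropNineOne
import Literature.NumberTheory.GaloisRepresentations.ContinuousH1SahNormal
import Literature.NumberTheory.EllipticCurves.TwoAdicImageSurjectivityModTwoProofs
import HarnessLib

/-!
# Route ByReductionTypeAtTwo, crux `RankOneAtTwoBigImageOddLocal` (stmt-BirchSwinnertonDyer-23715), LINE v8.9 `one_door_analytic`:
# NO INFLATION DEFECT AT LEVEL `2` — `res : H¹(F, E[2]) → H¹(F(E[2]), E[2])` is injective when the mod-`2` image contains a `3`-cycle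

Width prover seat `bsd-line-fkl-p2` g10 (2026-08-28), `--supports stmt-BirchSwinnertonDyer-23715` (helper).  THEOREMS ONLY (no
definition, no named fact, no `sorry`).  BSD is not proved by any of this.

The Čebotarev leaves `ceb₁`, `ceb₂`, `ceb₂'` of the lead's `FirstDescentInput` (`…OneDoorFirstDescentDefs.lean`, p641630) come from route
GenusKolyvaginAtTwo's VISIBLE Čebotarev at `2` (`GenusExact.SelmerDescent.cebotarev_visible_rat_of_not_isSquare`, PROVED) for families that
are independent AFTER restriction to `Γ_{K(E[2])}` (hypothesis `hvis`, read through `h1Eval` on `torsionFixing`), i.e. through the map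
`rK : H¹(F, E[2]) → Hom(Γ_{F(E[2])}, E[2])` whose injectivity is Gross's Prop. 9.1 — printed for ODD `p` («`H¹(K(E_p)/K, E_p) = 0`»,
FALSE at level `2^M`, `M ≥ 2`: Lawson–Wuthrich's class `ξ_E`).  At the FIRST layer `M = 1` there is no defect: `H¹(G, E[2]) = 0` for
`G = Gal(F(E[2])/F) ≤ S₃` containing a `3`-cycle.  This file proves it in the tree's currency by the RELATIVE Sah lemma
(`galoisCohomology.res_one_injective_of_normal_of_forall_fixed_eq_zero`, tree theorem): with `Γ' = {σ : sign(permGal σ) = 1}` (the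
EVEN permutations of the three non-zero `2`-torsion points — a normal subgroup of index `≤ 2`, `= Γ_{F(√Δ)}`) and `z ∈ Γ'` acting as a
`3`-cycle, `z` commutes with `Γ'` modulo `Γ_{F(E[2])}` (`A₃` is abelian) and has no non-zero fixed vector on `E[2]`.

* §1 `Fin 3` bookkeeping (`decide`): a fixed-point-free permutation of three letters is even and commutes with every even one;
* §2 `res_divisionField_two_injective_of_threeCycle` — `W/F` elliptic (`char F = 0`), some `z ∈ Γ_F` moving every non-zero
  `2`-torsion point ⟹ `res : H¹(F, E[2]) → H¹(F(E[2]), E[2])` injective; `eq_zero_of_forall_h1Eval_two_eq_zero` — the `h1Eval` form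
  (Gross's Prop. 9.1 at `p = 2`, `M = 1`: `[x, ρ] = 0` for all `ρ ∈ Γ_{F(E[2])}` ⟹ `x = 0`; bridge `SylvesterTwoUpper.eq_zero_of_h1Eval_eq_zero_of_res_injective`);
* §3 `exists_threeCycle_of_hasSurjectiveModNGaloisRep_two` / `eq_zero_of_forall_h1Eval_two_eq_zero_of_surjective` — the slice case
  over `ℚ` (`ρ̄_{E,2}` onto `GL₂(𝔽₂) ≅ S₃` supplies the `3`-cycle).

References: [GrossLMS1991] Prop. 9.1; [McCallumLMS1991] §3 (restriction to `K(E_{p^M})`); [LawsonWuthrich2016] §7 (the level-`2` case);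
[Sah1968] Prop. 2.7 (b); [DokchitserDokchitserMathZ2012] proof of the Theorem.
-/

set_option autoImplicit false
-- the Theorems namespace of this sub repeats the summit name by design (D-0017 nested layout)
set_option linter.dupNamespace false

noncomputable section

open scoped Classical

namespace Summit.BirchSwinnertonDyer.BirchSwinnertonDyer.Theorems.RankOneAtTwoOneDoor

open WeierstrassCurve Field
open Literature.NumberTheory.EllipticCurves Literature.NumberTheory.GaloisRepresentations
open Literature.NumberTheory.EllipticCurves.DokchitserDokchitser2012

/-! ## §1 Three letters: a fixed-point-free permutation is a `3`-cycle -/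

/-- **Fact-free**: a permutation of `Fin 3` without fixed letters is EVEN. [folklore] -/
theorem sign_eq_one_of_forall_ne (g : Equiv.Perm (Fin 3)) (hg : ∀ i, g i ≠ i) : Equiv.Perm.sign g = 1 := by
  revert hg; revert g; decide

/-- **Fact-free**: a permutation of `Fin 3` without fixed letters commutes with every even permutation (`A₃` is abelian). [folklore] -/
theorem mul_eq_mul_of_forall_ne_of_sign_eq_one (g p : Equiv.Perm (Fin 3)) (hg : ∀ i, g i ≠ i) (hp : Equiv.Perm.sign p = 1) :
    p * g = g * p := by
  revert hp hg; revert g p; decide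

/-! ## §2 No inflation defect at level `2` -/

section General

universe u

variable {F : Type u} [Field F] [CharZero F] (W : WeierstrassCurve F) [W.IsElliptic]

/-- `2 ≠ 0` in a field of characteristic `0` (the standing hypothesis of the Dokchitser–Dokchitser bookkeeping). [folklore] -/
theorem two_ne_zero_of_charZero' : (2 : F) ≠ 0 := two_ne_zero

/-- `σ • T_i = T_{permGal σ i}`, read on an arbitrary point of `E[2] = {O, T₀, T₁, T₂}`: if `permGal σ` and `permGal τ` commute then
`σ` and `τ` commute on `E[2]`. [cite: SilvermanAEC2009, III.§7] -/
theorem smul_smul_eq_of_permGal_comm (σ τ : absoluteGaloisGroup F)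
    (h : permGal W two_ne_zero_of_charZero' σ * permGal W two_ne_zero_of_charZero' τ =
      permGal W two_ne_zero_of_charZero' τ * permGal W two_ne_zero_of_charZero' σ)
    (T : geomTorsion W 2) : σ • τ • T = τ • σ • T := by
  rcases eq_zero_or_eq_T W two_ne_zero_of_charZero' T with rfl | ⟨i, rfl⟩
  · simp only [smul_zero]
  · rw [← T_permGal, ← T_permGal, ← T_permGal, ← T_permGal, ← Equiv.Perm.mul_apply, ← Equiv.Perm.mul_apply, h]

/-- **NO INFLATION DEFECT AT LEVEL `2`: `res : H¹(F, E[2]) → H¹(F(E[2]), E[2])` is injective as soon as some `z ∈ Γ_F` moves every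
non-zero `2`-torsion point** (i.e. acts on `{T₀, T₁, T₂}` as a `3`-cycle; `char F = 0`).  Relative Sah lemma
(`galoisCohomology.res_one_injective_of_normal_of_forall_fixed_eq_zero`) with `Γ'` = the kernel of `sign ∘ permGal` (even permutations;
normal), `z ∈ Γ'` (a `3`-cycle is even), `z` central in `Γ'` modulo `Γ_{F(E[2])}` (`A₃` abelian, and `Γ_{F(E[2])}` is the kernel of the
action on `E[2]`: `mem_divisionField_iff`), and `z` without non-zero fixed vector.  Equivalently `H¹(Gal(F(E[2])/F), E[2]) = 0` — Gross's
Prop. 9.1 at `p = 2` for the first layer (no Lawson–Wuthrich class at `M = 1`). [cite: GrossLMS1991, Prop. 9.1]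
[cite: LawsonWuthrich2016, §7] [cite: Sah1968, Prop. 2.7 (b)] -/
theorem res_divisionField_two_injective_of_threeCycle
    (hz : ∃ z : absoluteGaloisGroup F, ∀ i : Fin 3, permGal W two_ne_zero_of_charZero' z i ≠ i) :
    Function.Injective (galoisCohomology.res (W.torsionGaloisModule ((2 : ℕ) : ℤ)) (W.divisionField 2) 1) := by
  obtain ⟨z, hz⟩ := hz
  haveI : Finite (geomTorsion W ((2 : ℕ) : ℤ)) := W.finite_geomTorsion_nat two_ne_zero
  -- `Γ'` = even permutations, as the kernel of `sign ∘ permGal`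
  let π : absoluteGaloisGroup F →* Equiv.Perm (Fin 3) :=
    MonoidHom.mk' (permGal W two_ne_zero_of_charZero') (permGal_mul W two_ne_zero_of_charZero')
  let Γ' : Subgroup (absoluteGaloisGroup F) := (Equiv.Perm.sign.comp π).ker
  have hmemΓ' : ∀ σ, σ ∈ Γ' ↔ Equiv.Perm.sign (permGal W two_ne_zero_of_charZero' σ) = 1 := fun σ => by
    rw [MonoidHom.mem_ker]; rfl
  have hzΓ' : z ∈ Γ' := (hmemΓ' z).mpr (sign_eq_one_of_forall_ne _ hz)
  refine galoisCohomology.res_one_injective_of_normal_of_forall_fixed_eq_zero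
    (W.torsionGaloisModule ((2 : ℕ) : ℤ)) (W.divisionField 2) Γ' hzΓ' ?_ ?_
  · -- `z` commutes with `Γ'` modulo `Γ_{F(E[2])}`
    intro σ hσ
    have hcomm := mul_eq_mul_of_forall_ne_of_sign_eq_one _ _ hz ((hmemΓ' σ).mp hσ)
    rw [QuotientGroup.eq, mem_absGaloisFixingSubgroup_iff]
    intro x hx
    refine (W.mem_divisionField_iff 2).mp hx _ fun T => ?_
    rw [mul_smul, inv_smul_eq_iff, mul_smul, mul_smul]
    exact smul_smul_eq_of_permGal_comm W z σ hcomm.symm T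
  · -- `z` has no non-zero fixed vector on `E[2]`
    intro T hT
    rw [torsionGaloisModule_apply_apply] at hT
    rcases eq_zero_or_eq_T W two_ne_zero_of_charZero' T with h0 | ⟨i, hi⟩
    · exact h0
    · exfalso
      apply hz i
      apply T_injective W two_ne_zero_of_charZero'
      rw [T_permGal, ← hi]
      exact hT

/-- **Gross's Prop. 9.1 at `p = 2`, first layer, in `h1Eval` currency**: if some `z ∈ Γ_F` moves every non-zero `2`-torsion point, a class
`x ∈ H¹(F, E[2])` with `[x, ρ] = 0` for all `ρ ∈ Γ_{F(E[2])}` is zero (§2 + the bridge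
`SylvesterTwoUpper.eq_zero_of_h1Eval_eq_zero_of_res_injective`).  This is the injectivity of `rK` behind the VISIBLE Čebotarev
hypotheses (`hvis`, `hres`) at `M = 1`. [cite: GrossLMS1991, Prop. 9.1] [cite: McCallumLMS1991, §3] -/
theorem eq_zero_of_forall_h1Eval_two_eq_zero
    (hz : ∃ z : absoluteGaloisGroup F, ∀ i : Fin 3, permGal W two_ne_zero_of_charZero' z i ≠ i)
    {x : galH1Torsion W ((2 : ℕ) : ℤ)} (hx : ∀ ρ ∈ torsionFixing W ((2 : ℕ) : ℤ), h1Eval W ((2 : ℕ) : ℤ) x ρ = 0) : x = 0 :=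
  SylvesterTwoUpper.eq_zero_of_h1Eval_eq_zero_of_res_injective W 2 (res_divisionField_two_injective_of_threeCycle W hz) hx

end General

/-! ## §3 The slice case: `ρ̄_{E,2}` onto supplies the `3`-cycle -/

section Surjective

universe u

variable {F : Type u} [Field F] [CharZero F] (W : WeierstrassCurve F) [W.IsElliptic]

/-- **Fact-free**: a permutation of three letters moving the letter `2` is either fixed-point-free or becomes so after the
transposition `(0 1)`. [folklore] -/
theorem forall_ne_or_forall_swap_mul_ne (h : Equiv.Perm (Fin 3)) (h2 : h 2 ≠ 2) :
    (∀ i, h i ≠ i) ∨ (∀ i, (Equiv.swap (0 : Fin 3) 1 * h) i ≠ i) := by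
  revert h2; revert h; decide

/-- **A `3`-cycle from surjectivity mod `2`**: if `ρ̄_{E,2} : Γ_F → Aut(E[2]) ≅ S₃` is onto, some `z ∈ Γ_F` moves every non-zero `2`-torsion
point (`σ₁` realising `T₀ ↔ T₁` and `σ₂` moving `T₂`: `σ₂` or `σ₁σ₂` is a `3`-cycle). [cite: DokchitserDokchitserMathZ2012, Theorem (1)]
[cite: SilvermanAEC2009, III.§7] -/
theorem exists_threeCycle_of_hasSurjectiveModNGaloisRep_two (hs : W.HasSurjectiveModNGaloisRep 2) :
    ∃ z : absoluteGaloisGroup F, ∀ i : Fin 3, permGal W two_ne_zero_of_charZero' z i ≠ i := by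
  -- `σ₁` realising the transposition `T₀ ↔ T₁`
  obtain ⟨σ₁, hσ₁⟩ := hs (Multiplicative.ofAdd (swapAut W two_ne_zero_of_charZero'))
  have hσ₁T : ∀ T : geomTorsion W 2, σ₁ • T = swapAut W two_ne_zero_of_charZero' T := fun T => by
    have h := galoisRepTorsion_apply W 2 σ₁ T
    rw [hσ₁, toAdd_ofAdd] at h
    exact h.symm
  have hg : permGal W two_ne_zero_of_charZero' σ₁ = Equiv.swap 0 1 := by
    refine Equiv.ext fun i => T_injective W two_ne_zero_of_charZero' ?_
    rw [T_permGal, hσ₁T, ← perm_swapAut W two_ne_zero_of_charZero', T_perm]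
  -- `σ₂` moving `T₂`
  have hT2 : T W two_ne_zero_of_charZero' 2 ≠ 0 := fun h => coe_T_ne_zero W two_ne_zero_of_charZero' 2 (by rw [h]; rfl)
  obtain ⟨φ, hφ⟩ := exists_addEquiv_apply_ne W two_ne_zero_of_charZero' hT2
  obtain ⟨σ₂, hσ₂⟩ := hs (Multiplicative.ofAdd φ)
  have hσ₂T : σ₂ • T W two_ne_zero_of_charZero' 2 = φ (T W two_ne_zero_of_charZero' 2) := by
    have h := galoisRepTorsion_apply W 2 σ₂ (T W two_ne_zero_of_charZero' 2)
    rw [hσ₂, toAdd_ofAdd] at h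
    exact h.symm
  have h2 : permGal W two_ne_zero_of_charZero' σ₂ 2 ≠ 2 := by
    intro h
    apply hφ
    rw [← hσ₂T, ← T_permGal, h]
  rcases forall_ne_or_forall_swap_mul_ne _ h2 with h3 | h3
  · exact ⟨σ₂, h3⟩
  · exact ⟨σ₁ * σ₂, fun i => by rw [permGal_mul, hg]; exact h3 i⟩

/-- **Gross's Prop. 9.1 at `p = 2`, first layer, on the slice**: `ρ̄_{W,2}` onto ⟹ a class `x ∈ H¹(F, W[2])` with `[x, ρ] = 0` for all
`ρ ∈ Γ_{F(W[2])}` is zero. [cite: GrossLMS1991, Prop. 9.1] [cite: LawsonWuthrich2016, §7] -/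
theorem eq_zero_of_forall_h1Eval_two_eq_zero_of_surjective (hs : W.HasSurjectiveModNGaloisRep 2)
    {x : galH1Torsion W ((2 : ℕ) : ℤ)} (hx : ∀ ρ ∈ torsionFixing W ((2 : ℕ) : ℤ), h1Eval W ((2 : ℕ) : ℤ) x ρ = 0) : x = 0 :=
  eq_zero_of_forall_h1Eval_two_eq_zero W (exists_threeCycle_of_hasSurjectiveModNGaloisRep_two W hs) hx

/-- **The restriction `H¹(F, W[2]) → H¹(F(W[2]), W[2])` is injective on the slice** (`ρ̄_{W,2}` onto). [cite: GrossLMS1991, Prop. 9.1] -/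
theorem res_divisionField_two_injective_of_surjective (hs : W.HasSurjectiveModNGaloisRep 2) :
    Function.Injective (galoisCohomology.res (W.torsionGaloisModule ((2 : ℕ) : ℤ)) (W.divisionField 2) 1) :=
  res_divisionField_two_injective_of_threeCycle W (exists_threeCycle_of_hasSurjectiveModNGaloisRep_two W hs)

end Surjective

end Summit.BirchSwinnertonDyer.BirchSwinnertonDyer.Theorems.RankOneAtTwoOneDoor

end
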